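import Literature.NumberTheory.LFunctions.NoRealZeroPrimeSumCriterion
import Literature.NumberTheory.LFunctions.PrimitiveQuadraticCharacterPrimeValues
import Literature.Barriers.RiemannHypothesis.EpsteinZetaRealZeros
import HarnessLib

/-!
# Lu–Zaman–Zhao certificates indexed by fundamental discriminants: the prime sum as a function
# of `D` alone, and the table theorem in discriminant form

Topic `Literature/NumberTheory/LFunctions`; namespace `Literature.NumberTheory.LFunctions.LuZamanZhao2026`
(continuing `NoRealZeroPrimeSumCriterion.lean`). Two small definitions (`kroneckerAtPrime D p`, the
Kronecker symbol `(D/p)` at a prime rendered with Mathlib's `jacobiSym` and `ZMod.χ₈`;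
`primeSumD D σ N`, the prime sum (2.3) as a function of the discriminant) and THEOREMS — no named
fact, no `sorry`.

A certified table (lineage B of the no-exceptional-zero column) is a list of rows
`(D, λ, N)` — `D` a fundamental discriminant, `λ` a Table-1 row, `N` a cut-off — for which interval
arithmetic has verified `rhs c λ ϕ E |D| < ∑_{p ≤ N} (log p/(p^σ − 1) + (D/p) log p/(p^σ − (D/p)))`,
`σ = 1 + λ/(10 log 10)` (Lu–Zaman–Zhao §2.2–§3: "we will loop through fundamental discriminants and
calculate the Kronecker symbol"). The kernel side must know that this prime sum IS the prime sum
`primeSum χ σ N` of the primitive quadratic character `χ` with `χ(−1) q = D`: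

* `re_apply_prime_eq_kroneckerAtPrime` — for `χ` primitive quadratic mod `q > 1`, `D = χ(−1) q` and
  every prime `p`: `ℜχ(p) = (D/p)` (odd `p`: `PrimitiveQuadratic.apply_natCast_eq_jacobiSym_sign_mul`;
  `p = 2`: `χ(2) = 0` for even `q`, the mod-8 rule `PrimitiveQuadratic.apply_two_eq_ite_sign_mul` for
  odd `q`, both matching `χ₈(D)`);
* `primeSum_eq_primeSumD` — `primeSum χ σ N = primeSumD (χ(−1) q) σ N`;
* **`noExceptionalZeroUpTo_of_discriminant_certificates`** — assume `LuZamanZhao2026.theorem21`,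
  `c > 0`, a base table `NoExceptionalZeroUpTo Q₀ c`, and for every fundamental discriminant `D`
  with `Q₀ < |D| ≤ Q` a row `(λ, ϕ, E) ∈ Table1` and `N` with
  `rhs c λ ϕ E |D| < primeSumD D (1 + rOf λ) N`; then `NoExceptionalZeroUpTo Q c`
  (`D = χ(−1) q` is a fundamental discriminant: `PrimitiveQuadratic.isFundamentalDiscriminant_sign_mul`,
  whose body is literally `Literature.Barriers.RiemannHypothesis.IsFundamentalDiscriminant`).

## References

* R. F. Lu, A. Zaman, H. Zhao, Math. Comp. (2026), doi:10.1090/mcom/4268 = arXiv:2602.03626,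
  §2.1–§2.2 ((2.3), (2.5)), §3 ((3.1)). [LuZamanZhao2026]
* H. L. Montgomery, R. C. Vaughan, *Multiplicative Number Theory I*, CUP 2007, §9.3, Theorem 9.13.
  [MontgomeryVaughan2007]
-/

noncomputable section

open Complex Finset
open scoped NumberTheorySymbols

namespace Literature.NumberTheory.LFunctions

namespace LuZamanZhao2026

open PrimitiveQuadratic Literature.Barriers.RiemannHypothesis

/-! ### The Kronecker symbol at a prime -/

/-- **The Kronecker symbol `(D/p)` at a prime `p`**, as an integer in `{0, 1, −1}`: for odd `p` the
Legendre/Jacobi symbol `J(D | p)`, for `p = 2` Kronecker's extension `(D/2) = χ₈(D)` (`0` if `D` is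
even, `1` if `D ≡ ±1 (mod 8)`, `−1` if `D ≡ ±3 (mod 8)`). (Only prime arguments are used.)
[cite: MontgomeryVaughan2007, §9.3 Theorem 9.13] -/
def kroneckerAtPrime (D : ℤ) (p : ℕ) : ℤ :=
  if p = 2 then ZMod.χ₈ (D : ZMod 8) else J(D | p)

/-- **The prime sum (2.3) as a function of the discriminant**:
`∑_{p ≤ N} (log p/(p^σ − 1) + (D/p) log p/(p^σ − (D/p)))`. [cite: LuZamanZhao2026, (2.3) and §2.2] -/
def primeSumD (D : ℤ) (σ : ℝ) (N : ℕ) : ℝ :=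
  ∑ p ∈ (range (N + 1)).filter Nat.Prime,
    (Real.log p / ((p : ℝ) ^ σ - 1) +
      (kroneckerAtPrime D p : ℝ) * Real.log p / ((p : ℝ) ^ σ - (kroneckerAtPrime D p : ℝ)))

/-! ### The character values at primes are the Kronecker symbols of `D = χ(−1) q` -/

/-- **`ℜχ(p) = (D/p)` at every prime `p`**, for `χ` primitive quadratic mod `q > 1` and `D = χ(−1) q`
(`s = χ(−1) = ±1` as an integer). Odd `p`: `χ(p) = J(D | p)`; `p = 2`: `χ(2) = 0 = χ₈(D)` if `q` is
even, and `χ(2) = ±1` by `D mod 8 ∈ {1, 5}`, again `= χ₈(D)`, if `q` is odd.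
[cite: MontgomeryVaughan2007, §9.3 Theorem 9.13] -/
theorem re_apply_prime_eq_kroneckerAtPrime {q : ℕ} [NeZero q] (h1 : 1 < q)
    {χ : DirichletCharacter ℂ q} (hprim : χ.IsPrimitive) (hquad : χ.IsQuadratic) {s : ℤ}
    (hs : χ (-1) = (s : ℂ)) (hs1 : s = 1 ∨ s = -1) {p : ℕ} (hp : p.Prime) :
    (χ (p : ZMod q)).re = (kroneckerAtPrime (s * q) p : ℝ) := by
  unfold kroneckerAtPrime
  by_cases hp2 : p = 2
  · subst hp2
    rw [if_pos rfl]
    rcases Nat.even_or_odd q with hev | hodd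
    · -- even modulus: both sides vanish (`D` is even)
      have h2 : (2 : ℤ) ∣ s * q := dvd_mul_of_dvd_right (by exact_mod_cast hev.two_dvd) s
      rw [Nat.cast_ofNat, apply_two_of_even hev χ, Complex.zero_re, ZMod.χ₈_int_eq_if_mod_eight,
        if_pos (Int.emod_eq_zero_of_dvd h2)]
      simp
    · -- odd modulus: the mod-8 rule on both sides
      have h15 := sign_mul_mod_eight hodd h1 hprim hquad hs hs1
      rw [Nat.cast_ofNat, apply_two_eq_ite_sign_mul hodd h1 hprim hquad hs hs1,
        ZMod.χ₈_int_eq_if_mod_eight]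
      generalize (s * q : ℤ) = D at h15 ⊢
      have hodd2 : ¬ D % 2 = 0 := by omega
      rcases h15 with h | h
      · rw [if_pos h, if_neg hodd2, if_pos (Or.inl h)]
        simp
      · rw [if_neg (show ¬ D % 8 = 1 by omega), if_neg hodd2,
          if_neg (show ¬ (D % 8 = 1 ∨ D % 8 = 7) by omega)]
        simp
  · rw [if_neg hp2, apply_natCast_eq_jacobiSym_sign_mul hprim hquad hs hs1 (hp.odd_of_ne_two hp2)]
    exact_mod_cast Complex.intCast_re _

/-- **The prime sum of `χ` is the discriminant prime sum of `D = χ(−1) q`** (`q > 1`):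
`primeSum χ σ N = primeSumD (χ(−1) q) σ N`. [cite: LuZamanZhao2026, (2.3) and §2.2] -/
theorem primeSum_eq_primeSumD {q : ℕ} [NeZero q] (h1 : 1 < q) {χ : DirichletCharacter ℂ q}
    (hprim : χ.IsPrimitive) (hquad : χ.IsQuadratic) {s : ℤ} (hs : χ (-1) = (s : ℂ))
    (hs1 : s = 1 ∨ s = -1) (σ : ℝ) (N : ℕ) :
    primeSum χ σ N = primeSumD (s * q) σ N := by
  unfold primeSum primeSumD
  refine sum_congr rfl fun p hp ↦ ?_
  rw [re_apply_prime_eq_kroneckerAtPrime h1 hprim hquad hs hs1 (mem_filter.1 hp).2]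

/-! ### The table theorem in discriminant form -/

/-- **A table of discriminant certificates is a no-exceptional-zero table.** Assume
`LuZamanZhao2026.theorem21` and `c > 0`, a base table `NoExceptionalZeroUpTo Q₀ c` (e.g. Platt's range
`Q₀ = 4·10⁵` for `c ≤ 1/2`), and that for every fundamental discriminant `D` with `Q₀ < |D| ≤ Q` some
row `(λ, ϕ, E)` of Table 1 and some `N` satisfy the certified inequality
`rhs c λ ϕ E |D| < primeSumD D (1 + rOf λ) N` ((2.5) fails). Then `NoExceptionalZeroUpTo Q c`.
(A primitive quadratic `χ` mod `q` has `D = χ(−1) q` fundamental with `|D| = q`, and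
`primeSum χ = primeSumD D`; conclude by the decision rule `lfunction_ne_zero_of_rhs_lt_primeSum`.)
[cite: LuZamanZhao2026, §2.1–§3] -/
theorem noExceptionalZeroUpTo_of_discriminant_certificates (h21 : theorem21) {Q₀ Q : ℕ} {c : ℝ}
    (hc : 0 < c) (h₀ : NoExceptionalZeroUpTo Q₀ c)
    (hcert : ∀ D : ℤ, IsFundamentalDiscriminant D → (Q₀ : ℤ) < |D| → |D| ≤ (Q : ℤ) →
      ∃ lam phi E : ℝ, Table1 lam phi E ∧
        ∃ N : ℕ, rhs c lam phi E D.natAbs < primeSumD D (1 + rOf lam) N) :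
    NoExceptionalZeroUpTo Q c := by
  intro q _ hq3 hqQ χ hquad hprim σ hσ0 hσ hσ1
  by_cases hq₀ : q ≤ Q₀
  · exact h₀ q hq3 hq₀ χ hquad hprim σ hσ0 hσ hσ1
  have hq₀' : Q₀ < q := lt_of_not_ge hq₀
  have h1 : 1 < q := by omega
  obtain ⟨s, hs1, hs⟩ := exists_sign_eq χ
  have hs1' : s = 1 ∨ s = -1 := by
    rcases hs1 with ⟨h, -⟩ | ⟨h, -⟩
    · exact Or.inl h
    · exact Or.inr h
  have hfd : IsFundamentalDiscriminant (s * q) :=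
    isFundamentalDiscriminant_sign_mul hprim hquad hs hs1' h1
  have habs : |(s * q : ℤ)| = q := by
    rcases hs1' with rfl | rfl <;> simp
  have hnat : (s * q : ℤ).natAbs = q := by
    have := congrArg Int.natAbs habs
    rwa [Int.natAbs_abs, Int.natAbs_natCast] at this
  obtain ⟨lam, phi, E, hrow, N, hN⟩ :=
    hcert (s * q) hfd (by rw [habs]; exact_mod_cast hq₀') (by rw [habs]; exact_mod_cast hqQ)
  rw [hnat, ← primeSum_eq_primeSumD h1 hprim hquad hs hs1' (1 + rOf lam) N] at hN
  exact lfunction_ne_zero_of_rhs_lt_primeSum h21 hq3 hprim hquad hrow hc hN hσ0 hσ hσ1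

end LuZamanZhao2026

end Literature.NumberTheory.LFunctions

end
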